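import Mathlib
import Summits.ValiantsHypothesis.ValiantsHypothesis.Theorems.NewtonUnitEquationsTwoProductsRadixResidueOff
import Summits.ValiantsHypothesis.ValiantsHypothesis.Theorems.NewtonUnitEquationsTwoProductsRadixResidueOn

/-!
# Rigid radix products: `#swVert(∏_i φ_i(x^{M^i}, y^{M^i}) − 1) ≤ k³ q² t` (lead c6, crux TwoProducts)

The composition of the registered rung `stub_engineRadix` from the two residue pieces
`stub_radixResidueOff` (off-lattice south-west vertices of `F · expand M C` are monomials of `F`) and
`stub_radixResidueOn` (Mahler identity `coeff_{M•q}(F · expand M C) = coeff_q(F₀ · C)`), by induction on the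
number of scales with a general first factor `F` (`≤ T` monomials, box `[0, bM)²`):
`V(F · expand M (∏_{i<k} expand (M^i) φ_i)) ≤ T + k (b + kq)² t`.
-/

set_option linter.dupNamespace false

namespace Summit.ValiantsHypothesis.ValiantsHypothesis.Theorems.TwoProducts.Radix

open scoped BigOperators Pointwise
open MvPolynomial

noncomputable section

/-! ## The lattice part `F₀` of a polynomial -/

/-- `EDIV M (M • d) = d` for `M ≥ 1`. -/
theorem ediv_smul {M : ℕ} (hM : 1 ≤ M) (d : Fin 2 →₀ ℕ) : (Finsupp.mapRange (· / M) (Nat.zero_div M) (M • d) : Fin 2 →₀ ℕ) = d := by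
  ext i
  simp [Nat.mul_div_cancel_left _ hM]

/-- A lattice point is `M •` its quotient. -/
theorem smul_ediv_of_dvd {M : ℕ} {e : Fin 2 →₀ ℕ} (h : M ∣ e 0 ∧ M ∣ e 1) : M • (Finsupp.mapRange (· / M) (Nat.zero_div M) (e) : Fin 2 →₀ ℕ) = e := by
  ext i
  fin_cases i
  · simpa using Nat.mul_div_cancel' h.1
  · simpa using Nat.mul_div_cancel' h.2

/-- The defining coefficient identity of the lattice part. -/
theorem coeff_latticePart {M : ℕ} (hM : 1 ≤ M) (F : MvPolynomial (Fin 2) ℂ) (d : Fin 2 →₀ ℕ) :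
    coeff d (∑ d ∈ (MvPolynomial.support (F)).image (fun e => (Finsupp.mapRange (· / M) (Nat.zero_div M) e : Fin 2 →₀ ℕ)), MvPolynomial.monomial d (MvPolynomial.coeff (M • d) (F)) : MvPolynomial (Fin 2) ℂ) = coeff (M • d) F := by
  classical
  rw [coeff_sum]
  simp only [coeff_monomial]
  rw [Finset.sum_ite_eq']
  split_ifs with h
  · rfl
  · symm
    by_contra hne
    apply h
    exact Finset.mem_image.2 ⟨M • d, mem_support_iff.2 hne, ediv_smul hM d⟩

/-- Support of the lattice part. -/
theorem mem_support_latticePart {M : ℕ} (hM : 1 ≤ M) (F : MvPolynomial (Fin 2) ℂ) (d : Fin 2 →₀ ℕ) :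
    d ∈ ((∑ d ∈ (MvPolynomial.support (F)).image (fun e => (Finsupp.mapRange (· / M) (Nat.zero_div M) e : Fin 2 →₀ ℕ)), MvPolynomial.monomial d (MvPolynomial.coeff (M • d) (F)) : MvPolynomial (Fin 2) ℂ)).support ↔ M • d ∈ F.support := by
  rw [mem_support_iff, mem_support_iff, coeff_latticePart hM]

/-- Support points of the lattice part lie in the box `[0, b)²` if `supp F ⊆ [0, bM)²`. -/
theorem latticePart_box {M b : ℕ} (hM : 1 ≤ M) (F : MvPolynomial (Fin 2) ℂ)
    (hF : ∀ e ∈ F.support, e 0 < b * M ∧ e 1 < b * M) :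
    ∀ d ∈ ((∑ d ∈ (MvPolynomial.support (F)).image (fun e => (Finsupp.mapRange (· / M) (Nat.zero_div M) e : Fin 2 →₀ ℕ)), MvPolynomial.monomial d (MvPolynomial.coeff (M • d) (F)) : MvPolynomial (Fin 2) ℂ)).support, d 0 < b ∧ d 1 < b := by
  intro d hd
  rw [mem_support_latticePart hM] at hd
  obtain ⟨h0, h1⟩ := hF _ hd
  simp only [Finsupp.smul_apply, smul_eq_mul] at h0 h1
  rw [mul_comm b M] at h0 h1
  exact ⟨Nat.lt_of_mul_lt_mul_left h0, Nat.lt_of_mul_lt_mul_left h1⟩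

/-- A finite set of exponent vectors inside the box `[0, b)²` has at most `b * b` elements. -/
theorem card_le_of_box {b : ℕ} (S : Finset (Fin 2 →₀ ℕ)) (hS : ∀ d ∈ S, d 0 < b ∧ d 1 < b) :
    S.card ≤ b * b := by
  classical
  have hinj : Set.InjOn (fun d : (Fin 2 →₀ ℕ) => (d 0, d 1)) S := by
    intro d _ d' _ h
    simp only [Prod.mk.injEq] at h
    ext i
    fin_cases i
    · exact h.1
    · exact h.2
  calc S.card = (S.image fun d : (Fin 2 →₀ ℕ) => (d 0, d 1)).card := (Finset.card_image_of_injOn hinj).symm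
    _ ≤ (Finset.range b ×ˢ Finset.range b).card := by
        apply Finset.card_le_card
        intro p hp
        obtain ⟨d, hd, rfl⟩ := Finset.mem_image.1 hp
        simp [hS d hd]
    _ = b * b := by simp

/-! ## Weights, supports, constant terms -/

/-- Weights scale: `wt w (M • e) = M · wt w e`. -/
theorem wt_smul (w : Fin 2 → ℤ) (M : ℕ) (e : Fin 2 →₀ ℕ) : ((w) 0 * ((M • e : Fin 2 →₀ ℕ) 0 : ℤ) + (w) 1 * ((M • e : Fin 2 →₀ ℕ) 1 : ℤ)) = (M : ℤ) * ((w) 0 * ((e : Fin 2 →₀ ℕ) 0 : ℤ) + (w) 1 * ((e : Fin 2 →₀ ℕ) 1 : ℤ)) := by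
  simp only [Finsupp.smul_apply, smul_eq_mul, Nat.cast_mul]
  ring

/-- Scaling a nonzero exponent by `M ≥ 1` keeps it nonzero. -/
theorem smul_ne_zero_of_ne_zero {M : ℕ} (hM : 1 ≤ M) {e : Fin 2 →₀ ℕ} (he : e ≠ 0) : M • e ≠ 0 := by
  intro h
  apply he
  ext i
  have := congrArg (fun f : (Fin 2 →₀ ℕ) => f i) h
  simp only [Finsupp.smul_apply, smul_eq_mul, Finsupp.coe_zero, Pi.zero_apply, mul_eq_zero] at this
  rcases this with h1 | h1
  · omega
  · simpa using h1

/-- South-west vertices are support points. -/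
theorem swv_subset_support (P : MvPolynomial (Fin 2) ℂ) : {e : Fin 2 →₀ ℕ | ∃ w : Fin 2 → ℤ, 0 < w 0 ∧ 0 < w 1 ∧ e ≠ 0 ∧ e ∈ MvPolynomial.support (P) ∧ ∀ e' ∈ MvPolynomial.support (P), e' ≠ 0 → e' ≠ e → w 0 * (e 0 : ℤ) + w 1 * (e 1 : ℤ) < w 0 * (e' 0 : ℤ) + w 1 * (e' 1 : ℤ)} ⊆ (P.support : Set (Fin 2 →₀ ℕ)) := by
  rintro e ⟨w, -, -, -, he, -⟩
  exact he

/-- The south-west vertex set is finite. -/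
theorem swv_finite (P : MvPolynomial (Fin 2) ℂ) : ({e : Fin 2 →₀ ℕ | ∃ w : Fin 2 → ℤ, 0 < w 0 ∧ 0 < w 1 ∧ e ≠ 0 ∧ e ∈ MvPolynomial.support (P) ∧ ∀ e' ∈ MvPolynomial.support (P), e' ≠ 0 → e' ≠ e → w 0 * (e 0 : ℤ) + w 1 * (e 1 : ℤ) < w 0 * (e' 0 : ℤ) + w 1 * (e' 1 : ℤ)}).Finite :=
  (Finset.finite_toSet _).subset (swv_subset_support P)

/-- `expand N` (`N ≥ 1`) keeps the constant term. -/
theorem coeff_zero_expand_of_pos {N : ℕ} (hN : 1 ≤ N) (f : MvPolynomial (Fin 2) ℂ) :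
    coeff 0 (expand N f) = coeff 0 f :=
  coeff_expand_zero N (by omega) f

/-- A multiscale product of polynomials with constant terms `1` has constant term `1`. -/
theorem coeff_zero_prod_expand {k M : ℕ} (hM : 1 ≤ M) (φ : Fin k → MvPolynomial (Fin 2) ℂ)
    (h : ∀ i, coeff 0 (φ i) = 1) : coeff 0 (∏ i : Fin k, expand (M ^ (i : ℕ)) (φ i)) = 1 := by
  rw [← constantCoeff_eq, map_prod]
  refine Finset.prod_eq_one ?_
  intro i _
  rw [constantCoeff_eq, coeff_zero_expand_of_pos (Nat.one_le_pow _ _ hM), h i]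

/-- `∏_{i<k+1} expand (M^i) (φ i) = φ 0 * expand M (∏_{i<k} expand (M^i) (φ (i+1)))` — the Mahler step. -/
theorem prod_expand_succ (M : ℕ) {k : ℕ} (φ : Fin (k + 1) → MvPolynomial (Fin 2) ℂ) :
    ∏ i : Fin (k + 1), expand (M ^ (i : ℕ)) (φ i) =
      φ 0 * expand M (∏ i : Fin k, expand (M ^ (i : ℕ)) (φ i.succ)) := by
  rw [Fin.prod_univ_succ, map_prod]
  congr 1
  · simp
  · refine Finset.prod_congr rfl ?_
    intro i _
    rw [Fin.val_succ, pow_succ', expand_mul]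

/-- Support of `P − 1` when `P(0) = 1`: the nonzero support points of `P`. -/
theorem mem_support_sub_one {P : MvPolynomial (Fin 2) ℂ} (hP : coeff 0 P = 1) (e : Fin 2 →₀ ℕ) :
    e ∈ (P - 1).support ↔ e ≠ 0 ∧ e ∈ P.support := by
  rw [mem_support_iff, mem_support_iff, coeff_sub, coeff_one]
  by_cases he : e = 0
  · subst he
    simp [hP]
  · simp [he, Ne.symm he]

/-! ## One residue step -/

/-- THE RESIDUE STEP.  With `C(0) = 1`: a south-west vertex of `supp(F · expand M C) ∖ 0` is a monomial of `F`
(off the lattice) or `M •` a south-west vertex of `supp(F₀ · C) ∖ 0` (on the lattice). -/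
theorem step {M : ℕ} (hM : 1 ≤ M) (F C : MvPolynomial (Fin 2) ℂ)
    (hC : coeff 0 C = 1) :
    {e : Fin 2 →₀ ℕ | ∃ w : Fin 2 → ℤ, 0 < w 0 ∧ 0 < w 1 ∧ e ≠ 0 ∧ e ∈ MvPolynomial.support (F * expand M C) ∧ ∀ e' ∈ MvPolynomial.support (F * expand M C), e' ≠ 0 → e' ≠ e → w 0 * (e 0 : ℤ) + w 1 * (e 1 : ℤ) < w 0 * (e' 0 : ℤ) + w 1 * (e' 1 : ℤ)} ⊆ (F.support : Set (Fin 2 →₀ ℕ)) ∪ (fun e => M • e) '' {e : Fin 2 →₀ ℕ | ∃ w : Fin 2 → ℤ, 0 < w 0 ∧ 0 < w 1 ∧ e ≠ 0 ∧ e ∈ MvPolynomial.support ((∑ d ∈ (MvPolynomial.support (F)).image (fun e => (Finsupp.mapRange (· / M) (Nat.zero_div M) e : Fin 2 →₀ ℕ)), MvPolynomial.monomial d (MvPolynomial.coeff (M • d) (F)) : MvPolynomial (Fin 2) ℂ) * C) ∧ ∀ e' ∈ MvPolynomial.support ((∑ d ∈ (MvPolynomial.support (F)).image (fun e => (Finsupp.mapRange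 (· / M) (Nat.zero_div M) e : Fin 2 →₀ ℕ)), MvPolynomial.monomial d (MvPolynomial.coeff (M • d) (F)) : MvPolynomial (Fin 2) ℂ) * C), e' ≠ 0 → e' ≠ e → w 0 * (e 0 : ℤ) + w 1 * (e 1 : ℤ) < w 0 * (e' 0 : ℤ) + w 1 * (e' 1 : ℤ)} := by
  rintro e ⟨w, hw0, hw1, he0, heP, hmin⟩
  by_cases hdvd : M ∣ e 0 ∧ M ∣ e 1
  · right
    have hcoef : ∀ q : Fin 2 →₀ ℕ, coeff (M • q) (F * expand M C) = coeff q ((∑ d ∈ (MvPolynomial.support (F)).image (fun e => (Finsupp.mapRange (· / M) (Nat.zero_div M) e : Fin 2 →₀ ℕ)), MvPolynomial.monomial d (MvPolynomial.coeff (M • d) (F)) : MvPolynomial (Fin 2) ℂ) * C) :=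
      RadixResidueOn.stub_radixResidueOn M F ((∑ d ∈ (MvPolynomial.support (F)).image (fun e => (Finsupp.mapRange (· / M) (Nat.zero_div M) e : Fin 2 →₀ ℕ)), MvPolynomial.monomial d (MvPolynomial.coeff (M • d) (F)) : MvPolynomial (Fin 2) ℂ)) C hM (coeff_latticePart hM F)
    refine ⟨(Finsupp.mapRange (· / M) (Nat.zero_div M) (e) : Fin 2 →₀ ℕ), ?_, smul_ediv_of_dvd hdvd⟩
    have hee : M • (Finsupp.mapRange (· / M) (Nat.zero_div M) (e) : Fin 2 →₀ ℕ) = e := smul_ediv_of_dvd hdvd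
    refine ⟨w, hw0, hw1, ?_, ?_, ?_⟩
    · intro h0
      apply he0
      rw [← hee, h0, smul_zero]
    · rw [mem_support_iff, ← hcoef, hee]
      exact mem_support_iff.1 heP
    · intro q hq hq0 hqe
      have hMq : M • q ∈ (F * expand M C).support := by
        rw [mem_support_iff, hcoef]
        exact mem_support_iff.1 hq
      have hMq0 : M • q ≠ 0 := smul_ne_zero_of_ne_zero hM hq0
      have hMqe : M • q ≠ e := by
        intro h
        apply hqe
        rw [← ediv_smul hM q, h]
      have hlt := hmin (M • q) hMq hMq0 hMqe
      have h1' : ((w) 0 * ((e : Fin 2 →₀ ℕ) 0 : ℤ) + (w) 1 * ((e : Fin 2 →₀ ℕ) 1 : ℤ)) < ((w) 0 * ((M • q : Fin 2 →₀ ℕ) 0 : ℤ) + (w) 1 * ((M • q : Fin 2 →₀ ℕ) 1 : ℤ)) := hlt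
      rw [← hee, wt_smul, wt_smul] at h1'
      have hMpos : (0 : ℤ) < (M : ℤ) := by exact_mod_cast hM
      exact lt_of_mul_lt_mul_left h1' hMpos.le
  · left
    have hC0 : coeff 0 C ≠ 0 := by rw [hC]; exact one_ne_zero
    exact Finset.mem_coe.2 (RadixResidueOff.stub_radixResidueOff M F C hM hC0 w hw0 hw1 e he0 heP hmin hdvd)

/-! ## The induction on the number of scales -/

/-- Generalised bound: first factor `F` with `≤ T` monomials in the box `[0, bM)²`, then `k` scales of digit
polynomials (`≤ t` monomials, box `[0, qM)²`, constant terms `1`):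
`#swv(F · expand M (∏_{i<k} expand (M^i) φ_i)) ≤ T + k (b + kq)² t`. -/
theorem gen : ∀ (k M q t T b : ℕ) (F : MvPolynomial (Fin 2) ℂ)
    (φ : Fin k → MvPolynomial (Fin 2) ℂ), 1 ≤ M → coeff 0 F = 1 → F.support.card ≤ T →
    (∀ e ∈ F.support, e 0 < b * M ∧ e 1 < b * M) →
    (∀ i, coeff 0 (φ i) = 1) → (∀ i, (φ i).support.card ≤ t) →
    (∀ i, ∀ e ∈ (φ i).support, e 0 < q * M ∧ e 1 < q * M) →
    ({e : Fin 2 →₀ ℕ | ∃ w : Fin 2 → ℤ, 0 < w 0 ∧ 0 < w 1 ∧ e ≠ 0 ∧ e ∈ MvPolynomial.support (F * expand M (∏ i : Fin k, expand (M ^ (i : ℕ)) (φ i))) ∧ ∀ e' ∈ MvPolynomial.support (F * expand M (∏ i : Fin k, expand (M ^ (i : ℕ)) (φ i))), e' ≠ 0 → e' ≠ e → w 0 * (e 0 : ℤ) + w 1 * (e 1 : ℤ) < w 0 * (e' 0 : ℤ) + w 1 * (e' 1 : ℤ)}).ncard ≤ T + k * (b + k * q) ^ 2 * t := by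
  intro k
  induction k with
  | zero =>
    intro M q t T b F φ hM _ hT _ _ _ _
    simp only [Finset.univ_eq_empty, Finset.prod_empty, map_one, mul_one, zero_mul, add_zero]
    calc ({e : Fin 2 →₀ ℕ | ∃ w : Fin 2 → ℤ, 0 < w 0 ∧ 0 < w 1 ∧ e ≠ 0 ∧ e ∈ MvPolynomial.support (F) ∧ ∀ e' ∈ MvPolynomial.support (F), e' ≠ 0 → e' ≠ e → w 0 * (e 0 : ℤ) + w 1 * (e 1 : ℤ) < w 0 * (e' 0 : ℤ) + w 1 * (e' 1 : ℤ)}).ncard ≤ (F.support : Set (Fin 2 →₀ ℕ)).ncard := Set.ncard_le_ncard (swv_subset_support F)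
      _ = F.support.card := Set.ncard_coe_finset _
      _ ≤ T := hT
  | succ k ih =>
    intro M q t T b F φ hM hF0 hT hFbox hφ0 hφt hφbox
    rw [prod_expand_succ]
    set C' : MvPolynomial (Fin 2) ℂ := ∏ i : Fin k, expand (M ^ (i : ℕ)) (φ i.succ) with hC'
    set C : MvPolynomial (Fin 2) ℂ := φ 0 * expand M C' with hCdef
    set F₀ := (∑ d ∈ (MvPolynomial.support (F)).image (fun e => (Finsupp.mapRange (· / M) (Nat.zero_div M) e : Fin 2 →₀ ℕ)), MvPolynomial.monomial d (MvPolynomial.coeff (M • d) (F)) : MvPolynomial (Fin 2) ℂ) with hF₀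
    have hC'0 : coeff 0 C' = 1 := coeff_zero_prod_expand hM _ (fun i => hφ0 i.succ)
    have hC0 : coeff 0 C = 1 := by
      rw [hCdef, ← constantCoeff_eq, map_mul, constantCoeff_eq, hφ0 0,
        coeff_zero_expand_of_pos hM, hC'0, mul_one]
    -- the smaller instance
    have hF₀0 : coeff 0 F₀ = 1 := by rw [hF₀, coeff_latticePart hM, smul_zero, hF0]
    have hF₀box : ∀ d ∈ F₀.support, d 0 < b ∧ d 1 < b := latticePart_box hM F hFbox
    have hF₀card : F₀.support.card ≤ b * b := card_le_of_box _ hF₀box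
    set F' : MvPolynomial (Fin 2) ℂ := F₀ * φ 0 with hF'
    have hF'0 : coeff 0 F' = 1 := by
      rw [hF', ← constantCoeff_eq, map_mul, constantCoeff_eq, hF₀0, hφ0 0, mul_one]
    have hF'card : F'.support.card ≤ b * b * t := by
      calc F'.support.card ≤ (F₀.support + (φ 0).support).card := Finset.card_le_card (support_mul _ _)
        _ ≤ F₀.support.card * (φ 0).support.card := Finset.card_add_le
        _ ≤ b * b * t := Nat.mul_le_mul hF₀card (hφt 0)
    have hF'box : ∀ e ∈ F'.support, e 0 < (b + q) * M ∧ e 1 < (b + q) * M := by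
      intro e he
      have he' := support_mul _ _ he
      obtain ⟨d, hd, d', hd', rfl⟩ := Finset.mem_add.1 he'
      obtain ⟨hd0, hd1⟩ := hF₀box d hd
      obtain ⟨hd'0, hd'1⟩ := hφbox 0 d' hd'
      simp only [Finsupp.add_apply]
      have hb : b ≤ b * M := Nat.le_mul_of_pos_right _ hM
      have hbq : (b + q) * M = b * M + q * M := by ring
      rw [hbq]
      constructor
      · linarith
      · linarith
    have hIH := ih M q t (b * b * t) (b + q) F' (fun i => φ i.succ) hM hF'0 hF'card hF'box
      (fun i => hφ0 i.succ) (fun i => hφt i.succ) (fun i => hφbox i.succ)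
    -- the residue step
    have hstep := step hM F C hC0
    have hassoc : F₀ * C = F' * expand M C' := by rw [hF', hCdef, mul_assoc]
    have hfinU : ((F.support : Set (Fin 2 →₀ ℕ)) ∪ (fun e => M • e) '' {e : Fin 2 →₀ ℕ | ∃ w : Fin 2 → ℤ, 0 < w 0 ∧ 0 < w 1 ∧ e ≠ 0 ∧ e ∈ MvPolynomial.support (F₀ * C) ∧ ∀ e' ∈ MvPolynomial.support (F₀ * C), e' ≠ 0 → e' ≠ e → w 0 * (e 0 : ℤ) + w 1 * (e 1 : ℤ) < w 0 * (e' 0 : ℤ) + w 1 * (e' 1 : ℤ)}).Finite :=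
      (Finset.finite_toSet _).union ((swv_finite _).image _)
    calc ({e : Fin 2 →₀ ℕ | ∃ w : Fin 2 → ℤ, 0 < w 0 ∧ 0 < w 1 ∧ e ≠ 0 ∧ e ∈ MvPolynomial.support (F * expand M C) ∧ ∀ e' ∈ MvPolynomial.support (F * expand M C), e' ≠ 0 → e' ≠ e → w 0 * (e 0 : ℤ) + w 1 * (e 1 : ℤ) < w 0 * (e' 0 : ℤ) + w 1 * (e' 1 : ℤ)}).ncard
        ≤ ((F.support : Set (Fin 2 →₀ ℕ)) ∪ (fun e => M • e) '' {e : Fin 2 →₀ ℕ | ∃ w : Fin 2 → ℤ, 0 < w 0 ∧ 0 < w 1 ∧ e ≠ 0 ∧ e ∈ MvPolynomial.support (F₀ * C) ∧ ∀ e' ∈ MvPolynomial.support (F₀ * C), e' ≠ 0 → e' ≠ e → w 0 * (e 0 : ℤ) + w 1 * (e 1 : ℤ) < w 0 * (e' 0 : ℤ) + w 1 * (e' 1 : ℤ)}).ncard := Set.ncard_le_ncard hstep hfinU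
      _ ≤ (F.support : Set (Fin 2 →₀ ℕ)).ncard + ((fun e => M • e) '' {e : Fin 2 →₀ ℕ | ∃ w : Fin 2 → ℤ, 0 < w 0 ∧ 0 < w 1 ∧ e ≠ 0 ∧ e ∈ MvPolynomial.support (F₀ * C) ∧ ∀ e' ∈ MvPolynomial.support (F₀ * C), e' ≠ 0 → e' ≠ e → w 0 * (e 0 : ℤ) + w 1 * (e 1 : ℤ) < w 0 * (e' 0 : ℤ) + w 1 * (e' 1 : ℤ)}).ncard := Set.ncard_union_le _ _
      _ ≤ T + ({e : Fin 2 →₀ ℕ | ∃ w : Fin 2 → ℤ, 0 < w 0 ∧ 0 < w 1 ∧ e ≠ 0 ∧ e ∈ MvPolynomial.support (F₀ * C) ∧ ∀ e' ∈ MvPolynomial.support (F₀ * C), e' ≠ 0 → e' ≠ e → w 0 * (e 0 : ℤ) + w 1 * (e 1 : ℤ) < w 0 * (e' 0 : ℤ) + w 1 * (e' 1 : ℤ)}).ncard := by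
          refine Nat.add_le_add ?_ (Set.ncard_image_le (swv_finite _))
          rw [Set.ncard_coe_finset]; exact hT
      _ = T + ({e : Fin 2 →₀ ℕ | ∃ w : Fin 2 → ℤ, 0 < w 0 ∧ 0 < w 1 ∧ e ≠ 0 ∧ e ∈ MvPolynomial.support (F' * expand M C') ∧ ∀ e' ∈ MvPolynomial.support (F' * expand M C'), e' ≠ 0 → e' ≠ e → w 0 * (e 0 : ℤ) + w 1 * (e 1 : ℤ) < w 0 * (e' 0 : ℤ) + w 1 * (e' 1 : ℤ)}).ncard := by rw [hassoc]
      _ ≤ T + (b * b * t + k * (b + q + k * q) ^ 2 * t) := Nat.add_le_add_left hIH _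
      _ ≤ T + (k + 1) * (b + (k + 1) * q) ^ 2 * t := by
          have hsq : b * b ≤ (b + (k + 1) * q) ^ 2 := by
            rw [← pow_two]; exact Nat.pow_le_pow_left (Nat.le_add_right _ _) 2
          have hsq' : b * b * t ≤ (b + (k + 1) * q) ^ 2 * t := Nat.mul_le_mul_right t hsq
          have heq : b + q + k * q = b + (k + 1) * q := by ring
          have hring : (k + 1) * (b + (k + 1) * q) ^ 2 * t =
              k * (b + (k + 1) * q) ^ 2 * t + (b + (k + 1) * q) ^ 2 * t := by ring
          rw [heq, hring]
          refine Nat.add_le_add_left ?_ T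
          rw [Nat.add_comm]
          exact Nat.add_le_add_left hsq' _

/-! ## The registered rung -/

/-- RUNG (lead c6) — RIGID RADIX PRODUCTS.  For `M ≥ 1`, digit polynomials `φ_i` (`i < k`) with constant terms `1`,
at most `t` monomials and all exponents `< q·M` in both coordinates, the south-west vertices (strict minimisers of a
strictly positive integer weight) of `(∏_i expand (M^i) φ_i) − 1` number at most `k³ q² t`: the multiscale-with-carries
regime `f_i = φ_i(x^{M^i}, y^{M^i})` of the crux in its one-product / first-order-count form, LINEAR in `t`.
(Residue decomposition `mod M`: `stub_radixResidueOff` + `stub_radixResidueOn`, induction on the number of scales.) -/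
theorem stub_engineRadix :
    ∀ (k M q t : ℕ) (φ : Fin k → MvPolynomial (Fin 2) ℂ), 1 ≤ M →
    (∀ i, MvPolynomial.coeff 0 (φ i) = 1) → (∀ i, (φ i).support.card ≤ t) →
    (∀ i, ∀ e ∈ (φ i).support, e 0 < q * M ∧ e 1 < q * M) →
    {e : Fin 2 →₀ ℕ | ∃ w : Fin 2 → ℤ, 0 < w 0 ∧ 0 < w 1 ∧
        e ∈ ((∏ i : Fin k, MvPolynomial.expand (M ^ (i : ℕ)) (φ i)) - 1).support ∧
        ∀ e' ∈ ((∏ i : Fin k, MvPolynomial.expand (M ^ (i : ℕ)) (φ i)) - 1).support, e' ≠ e →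
          w 0 * (e 0 : ℤ) + w 1 * (e 1 : ℤ) < w 0 * (e' 0 : ℤ) + w 1 * (e' 1 : ℤ)}.ncard ≤ k ^ 3 * q ^ 2 * t := by
  intro k M q t φ hM hφ0 hφt hφbox
  set P : MvPolynomial (Fin 2) ℂ := ∏ i : Fin k, expand (M ^ (i : ℕ)) (φ i) with hP
  have hP0 : coeff 0 P = 1 := coeff_zero_prod_expand hM φ hφ0
  -- the set of the statement is `swv P`
  have hset : {e : Fin 2 →₀ ℕ | ∃ w : Fin 2 → ℤ, 0 < w 0 ∧ 0 < w 1 ∧ e ∈ (P - 1).support ∧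
      ∀ e' ∈ (P - 1).support, e' ≠ e →
        w 0 * (e 0 : ℤ) + w 1 * (e 1 : ℤ) < w 0 * (e' 0 : ℤ) + w 1 * (e' 1 : ℤ)} = {e : Fin 2 →₀ ℕ | ∃ w : Fin 2 → ℤ, 0 < w 0 ∧ 0 < w 1 ∧ e ≠ 0 ∧ e ∈ MvPolynomial.support (P) ∧ ∀ e' ∈ MvPolynomial.support (P), e' ≠ 0 → e' ≠ e → w 0 * (e 0 : ℤ) + w 1 * (e 1 : ℤ) < w 0 * (e' 0 : ℤ) + w 1 * (e' 1 : ℤ)} := by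
    ext e
    simp only [Set.mem_setOf_eq, mem_support_sub_one hP0]
    constructor
    · rintro ⟨w, hw0, hw1, ⟨he0, he⟩, hmin⟩
      exact ⟨w, hw0, hw1, he0, he, fun e' he' he'0 hne => hmin e' ⟨he'0, he'⟩ hne⟩
    · rintro ⟨w, hw0, hw1, he0, he, hmin⟩
      exact ⟨w, hw0, hw1, ⟨he0, he⟩, fun e' he' hne => hmin e' he'.2 he'.1 hne⟩
  rw [hset]
  cases k with
  | zero =>
    have hP1 : P = 1 := by rw [hP]; simp
    have hempty : {e : Fin 2 →₀ ℕ | ∃ w : Fin 2 → ℤ, 0 < w 0 ∧ 0 < w 1 ∧ e ≠ 0 ∧ e ∈ MvPolynomial.support (P) ∧ ∀ e' ∈ MvPolynomial.support (P), e' ≠ 0 → e' ≠ e → w 0 * (e 0 : ℤ) + w 1 * (e 1 : ℤ) < w 0 * (e' 0 : ℤ) + w 1 * (e' 1 : ℤ)} = ∅ := by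
      rw [hP1]
      ext e
      simp only [Set.mem_setOf_eq, Set.mem_empty_iff_false, iff_false, not_exists, not_and]
      intro w _ _ he0 he _
      rw [mem_support_iff, coeff_one, if_neg (Ne.symm he0)] at he
      exact he rfl
    rw [hempty, Set.ncard_empty]
    positivity
  | succ k =>
    -- `q ≥ 1` (the constant term lies in the digit box)
    have hq : 1 ≤ q := by
      have h0mem : (0 : Fin 2 →₀ ℕ) ∈ (φ 0).support := by rw [mem_support_iff, hφ0 0]; exact one_ne_zero
      have := (hφbox 0 0 h0mem).1
      simp only [Finsupp.coe_zero, Pi.zero_apply] at this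
      rcases Nat.eq_zero_or_pos q with hq0 | hq0
      · subst hq0; simp at this
      · exact hq0
    have hsplit : P = φ 0 * expand M (∏ i : Fin k, expand (M ^ (i : ℕ)) (φ i.succ)) := by
      rw [hP, prod_expand_succ]
    have hgen := gen k M q t t q (φ 0) (fun i => φ i.succ) hM (hφ0 0) (hφt 0) (hφbox 0)
      (fun i => hφ0 i.succ) (fun i => hφt i.succ) (fun i => hφbox i.succ)
    rw [hsplit]
    calc ({e : Fin 2 →₀ ℕ | ∃ w : Fin 2 → ℤ, 0 < w 0 ∧ 0 < w 1 ∧ e ≠ 0 ∧ e ∈ MvPolynomial.support (φ 0 * expand M (∏ i : Fin k, expand (M ^ (i : ℕ)) (φ i.succ))) ∧ ∀ e' ∈ MvPolynomial.support (φ 0 * expand M (∏ i : Fin k, expand (M ^ (i : ℕ)) (φ i.succ))), e' ≠ 0 → e' ≠ e → w 0 * (e 0 : ℤ) + w 1 * (e 1 : ℤ) < w 0 * (e' 0 : ℤ) + w 1 * (e' 1 : ℤ)}).ncard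
        ≤ t + k * (q + k * q) ^ 2 * t := hgen
      _ ≤ (k + 1) ^ 3 * q ^ 2 * t := by
          have heq : q + k * q = (k + 1) * q := by ring
          have hring : (k + 1) ^ 3 * q ^ 2 * t = k * ((k + 1) * q) ^ 2 * t + (k + 1) ^ 2 * q ^ 2 * t := by ring
          have h1 : t ≤ (k + 1) ^ 2 * q ^ 2 * t :=
            Nat.le_mul_of_pos_left t (Nat.mul_pos (by positivity) (Nat.pow_pos hq))
          rw [heq, hring, Nat.add_comm]
          exact Nat.add_le_add_left h1 _

end

end Summit.ValiantsHypothesis.ValiantsHypothesis.Theorems.TwoProducts.Radix
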